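import Mathlib
import Literature.Combinatorics.StablePolynomials.HalfPlaneApolarity
import Summits.ValiantsHypothesis.ValiantsHypothesis.Theorems.GrenetZeonTwoDimCoefficientsScalingCompanionTwo
import Summits.ValiantsHypothesis.ValiantsHypothesis.Theorems.GrenetZeonTwoDimCoefficientsScalingIndexHdeg

/-!
# Crux `GrenetZeon.TwoDimCoefficients` (stmt-ValiantsHypothesis-8062), stub `stub_dualUnipotent`:
# scaling-closure — the first companion of an index-`n` pencil is `c⁻¹·e₂` of the TOP NUMERATOR

For a unipotent dual representation `per_n = α·c + β·tr(adj A·B)` whose numerator `P = adj A·B` has degree `≤ n`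
(e.g. every index-`n` normal form, ✓ `totalDegree_adjugate_le_of_index`), write `P = P^top + (degree < n)` with `P^top`
the matrix of degree-`n` components.  Then (✓ `companionTwo_eq`, top components multiply):

* `homogeneousComponent_trace_sq_top` — `[tr(P²)]_{2n} = tr((P^top)²)`;  `trace_top_eq` — `tr P^top = β⁻¹·per_n`;
* ★ `companionTwo_eq_top` — the order-two companion is `Ψ₂ = [D₂]_{2n} = (2c)⁻¹·((tr P^top)² − tr((P^top)²)) = c⁻¹·e₂(P^top)`
  (`companionTwo_eq_coeff_charpolyRev_top`); for an index-`n` normal form `P^top = c·(−N)^{n−1}A₀⁻¹B₁`, so the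
  shadow's first companion is `c·e₂` of the top trace-product matrix `Y = (−N)^{n−1}A₀⁻¹B₁` (`tr(cY) = β⁻¹per_n`);
* ★ `three_mul_le_of_top_e2` — consequently (✓ `three_mul_le_of_sqTrace`; `[tr(P²)]_d = 0` for `d > 2n` is automatic
  here): `n ≥ 6`, `deg(adj A·B) ≤ n` and `e₂(P^top) = 0` (e.g. `P^top` of rank one — single-output trace programs)
  ⟹ `m ≥ 3n`.

So on index-`n` pencils the order-two obstruction of the scaling-closure method is the single form `e₂(P^top)` of
degree `2n`; the memo SEVENTEENTH-HAND.md records the general pattern `Ψ_k = c⁻¹… e_k(P^top)`, i.e. shadow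
`= c·det(1 + c⁻¹P^top)`, of which this is the typed `k = 2` case.

HONEST FRAMING: an identity plus a bookkeeping corollary; the stub `DualUnipotentBound`, the crux and `VP ≠ VNP`
remain open.

References: folklore; R. P. Stanley, EC1, Cor. 4.7.3 (Newton at order two, via the tree).
-/

-- single-conjunct layout `Summits/ValiantsHypothesis/ValiantsHypothesis`: the duplicated namespace
-- component is mandated by the tree.
set_option linter.dupNamespace false
set_option autoImplicit false

noncomputable section

namespace Summit.ValiantsHypothesis.ValiantsHypothesis.Theorems.GrenetZeonTwoDimCoefficients.ScalingClosure

open MvPolynomial Matrix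
open Literature.Computability.AlgebraicComplexity
open Summit.ValiantsHypothesis.ValiantsHypothesis.Cruxes.TwoDimCoefficients.DimTwoCases

section Top

variable {σ : Type*} [DecidableEq σ] {ι : Type*} [Fintype ι] [DecidableEq ι]

/-- **Top component of a square-trace.**  If every entry of `P` has degree `≤ n` and `P^top` collects the degree-`n`
components, then `[tr(P²)]_{2n} = tr((P^top)²)`. [folklore] -/
theorem homogeneousComponent_trace_sq_top (n : ℕ) (P Ptop : Matrix ι ι (MvPolynomial σ ℂ))
    (hP : ∀ i j, (P i j).totalDegree ≤ n) (htop : ∀ i j, Ptop i j = homogeneousComponent n (P i j)) :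
    homogeneousComponent (2 * n) ((P ^ 2).trace) = (Ptop ^ 2).trace := by
  rw [sq, sq, Matrix.trace, Matrix.trace, map_sum]
  refine Finset.sum_congr rfl fun i _ => ?_
  rw [Matrix.diag_apply, Matrix.diag_apply, Matrix.mul_apply, Matrix.mul_apply, map_sum]
  refine Finset.sum_congr rfl fun j _ => ?_
  rw [two_mul, Literature.Combinatorics.StablePolynomials.homogeneousComponent_mul_of_totalDegree_le (hP i j) (hP j i),
    htop, htop]

/-- **Top component of the numerator trace**: `tr(P^top) = [tr P]_n = β⁻¹·per_n` (`n ≥ 1`). [folklore] -/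
theorem trace_top_eq {n : ℕ} (hn : 1 ≤ n) {m : ℕ} (A B : AffMat n m) (α β c : ℂ) (hβ : β ≠ 0)
    (hdet : A.det = MvPolynomial.C c)
    (hper : perPoly (Fin n) ℂ = MvPolynomial.C α * A.det + MvPolynomial.C β * (A.adjugate * B).trace)
    (Ptop : AffMat n m) (htop : ∀ i j, Ptop i j = homogeneousComponent n ((A.adjugate * B) i j)) :
    Ptop.trace = MvPolynomial.C β⁻¹ * perPoly (Fin n) ℂ := by
  have hP : (homogeneousComponent n) (A.adjugate * B).trace = Ptop.trace := by
    rw [Matrix.trace, Matrix.trace, map_sum]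
    exact Finset.sum_congr rfl fun i _ => by rw [Matrix.diag_apply, Matrix.diag_apply, htop]
  have hhom : (perPoly (Fin n) ℂ).IsHomogeneous n := by
    simpa only [Fintype.card_fin] using (perPoly_isHomogeneous (n := Fin n) (k := ℂ))
  rw [← hP, trace_adjugate_mul_eq_of_per A B α β c hβ hdet hper, homogeneousComponent_C_mul, map_sub,
    homogeneousComponent_of_mem ((mem_homogeneousSubmodule _ _).mpr hhom), if_pos rfl,
    homogeneousComponent_of_mem ((mem_homogeneousSubmodule _ _).mpr (isHomogeneous_C _ _)), if_neg (by omega),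
    sub_zero]

/-- ★ **The first companion from the top numerator.**  `det A = c ≠ 0`, `per_n = α·det A + β·tr(adj A·B)`, `β ≠ 0`,
`n ≥ 1`, `deg(adj A·B) ≤ n`, `P^top` the degree-`n` part of `adj A·B` ⟹
`[D₂]_{2n} = (2c)⁻¹·((tr P^top)² − tr((P^top)²))`. [folklore] -/
theorem companionTwo_eq_top {n m : ℕ} (hn : 1 ≤ n) (A B : AffMat n m) (α β c : ℂ) (hc : c ≠ 0) (hβ : β ≠ 0)
    (hdet : A.det = MvPolynomial.C c)
    (hper : perPoly (Fin n) ℂ = MvPolynomial.C α * A.det + MvPolynomial.C β * (A.adjugate * B).trace)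
    (hP : ∀ i j, ((A.adjugate * B) i j).totalDegree ≤ n)
    (Ptop : AffMat n m) (htop : ∀ i j, Ptop i j = homogeneousComponent n ((A.adjugate * B) i j)) :
    homogeneousComponent (2 * n) ((det ((Polynomial.X : Polynomial (MvPolynomial (Fin n × Fin n) ℂ)) •
        B.map Polynomial.C + A.map Polynomial.C)).coeff 2) =
      MvPolynomial.C (2 * c)⁻¹ * (Ptop.trace ^ 2 - (Ptop ^ 2).trace) := by
  rw [homogeneousComponent_coeff_det_two_two_mul hn A B α β c hc hβ hdet hper,
    homogeneousComponent_trace_sq_top n _ Ptop hP htop, trace_top_eq hn A B α β c hβ hdet hper Ptop htop, mul_pow,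
    ← map_pow]

/-- The same, as `c⁻¹·e₂(P^top)` with `e₂ = [X²] det(1 − X·P^top)`. [folklore] -/
theorem companionTwo_eq_coeff_charpolyRev_top {n m : ℕ} (hn : 1 ≤ n) (A B : AffMat n m) (α β c : ℂ)
    (hc : c ≠ 0) (hβ : β ≠ 0) (hdet : A.det = MvPolynomial.C c)
    (hper : perPoly (Fin n) ℂ = MvPolynomial.C α * A.det + MvPolynomial.C β * (A.adjugate * B).trace)
    (hP : ∀ i j, ((A.adjugate * B) i j).totalDegree ≤ n)
    (Ptop : AffMat n m) (htop : ∀ i j, Ptop i j = homogeneousComponent n ((A.adjugate * B) i j)) :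
    homogeneousComponent (2 * n) ((det ((Polynomial.X : Polynomial (MvPolynomial (Fin n × Fin n) ℂ)) •
        B.map Polynomial.C + A.map Polynomial.C)).coeff 2) =
      MvPolynomial.C c⁻¹ * Ptop.charpolyRev.coeff 2 := by
  rw [companionTwo_eq_top hn A B α β c hc hβ hdet hper hP Ptop htop, ← two_mul_coeff_charpolyRev_two, ← mul_assoc,
    ← map_ofNat (MvPolynomial.C : ℂ →+* MvPolynomial (Fin n × Fin n) ℂ) 2, ← map_mul,
    show ((2 * c)⁻¹ * (OfNat.ofNat 2 : ℂ) : ℂ) = c⁻¹ by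
      rw [mul_inv, mul_comm, ← mul_assoc, mul_inv_cancel₀ (two_ne_zero' ℂ), one_mul]]

omit [DecidableEq σ] in
/-- Entries of degree `≤ n` give a square-trace of degree `≤ 2n`. [folklore] -/
theorem totalDegree_trace_sq_le (n : ℕ) (P : Matrix ι ι (MvPolynomial σ ℂ)) (hP : ∀ i j, (P i j).totalDegree ≤ n) :
    ((P ^ 2).trace).totalDegree ≤ 2 * n := by
  rw [sq, Matrix.trace]
  refine (totalDegree_finsetSum _ _).trans (Finset.sup_le fun i _ => ?_)
  rw [Matrix.diag_apply, Matrix.mul_apply]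
  refine (totalDegree_finsetSum _ _).trans (Finset.sup_le fun j _ => ?_)
  exact (totalDegree_mul _ _).trans (by have := hP i j; have := hP j i; omega)

/-- ★ **`m ≥ 3n` from the top numerator.**  A unipotent dual representation of `per_n` (`n = k + 6 ≥ 6`, `m ≥ 2`) with
numerator of degree `≤ n` (index-`n` pencils) whose top numerator satisfies `(tr P^top)² = tr((P^top)²)` — i.e.
`e₂(P^top) = 0`, e.g. `P^top` of rank one — has `m ≥ 3n`. [cite: MignonRessayre2004, Thm. 1.1 — via the tree; folklore] -/
theorem three_mul_le_of_top_e2 {k m : ℕ} (A B : AffMat (k + 6) m) (hA : IsAffine A) (hB : IsAffine B)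
    (α β c : ℂ) (hc : c ≠ 0) (hβ : β ≠ 0) (hdet : A.det = MvPolynomial.C c)
    (hper : perPoly (Fin (k + 6)) ℂ =
      MvPolynomial.C α * A.det + MvPolynomial.C β * (A.adjugate * B).trace)
    (hm2 : 2 ≤ m) (hP : ∀ i j, ((A.adjugate * B) i j).totalDegree ≤ k + 6)
    (Ptop : AffMat (k + 6) m) (htop : ∀ i j, Ptop i j = homogeneousComponent (k + 6) ((A.adjugate * B) i j))
    (he2 : Ptop.trace ^ 2 = (Ptop ^ 2).trace) :
    3 * (k + 6) ≤ m := by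
  refine three_mul_le_of_sqTrace A B hA hB α β c hc hβ hdet hper hm2 (fun d hd _ => ?_) ?_
  · exact homogeneousComponent_eq_zero _ _ ((totalDegree_trace_sq_le (k + 6) _ hP).trans_lt hd)
  · rw [homogeneousComponent_trace_sq_top (k + 6) _ Ptop hP htop, ← he2,
      trace_top_eq (by omega) A B α β c hβ hdet hper Ptop htop, mul_pow, ← map_pow]

end Top

end Summit.ValiantsHypothesis.ValiantsHypothesis.Theorems.GrenetZeonTwoDimCoefficients.ScalingClosure

end
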